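import Summits.CriticalPhenomena.SAWScalingLimit.Theses.SAWRestrictionRigidity
import Summits.CriticalPhenomena.SAWScalingLimit.Theses.SAWGaussianRotation

/-!
# Skeleton line `isotropy-first` for crux `Rigidity` (stmt-CriticalPhenomena-1368), route SAWRestrictionRigidity
# (strategist alternative to the live line `registered` = birth; never overwrites it)

Cut along the SYMMETRY GROUP instead of along the linear modulus:

  D4-lattice similarities ──stub_isotropyBootstrap──▶ all similarities z ↦ c z + w
                          ──stub_similarityRigidity──▶ conformal covariance.

* `stub_isotropyBootstrap` (hardest, conjectural): under the crux hypotheses VERBATIM (chordal,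
  two-sided restriction, restriction-coupled domain Markov kernel, reversibility, covariance under
  `z ↦ r·iᵏ·z + w` and under conjugation, simple boundary-avoiding curves) the family is covariant
  under EVERY orientation-preserving similarity (`ChordalFamily.IsSimilarityCovariant`), i.e. the
  Euclidean quarter-turn bootstraps to the full rotation group. This is a CONSEQUENCE of the crux
  (`IsConformallyCovariant.isSimilarityCovariant`), hence cannot be falser than the crux; it is the
  exact continuum counterpart of the lattice step "rotational invariance of the scaling limit"
  (Duminil-Copin–Kozlowski–Krachun–Manolescu–Oulamara 2020 for FK percolation) and the home of every
  anisotropic would-be counterexample (Beffara's linear images `L_* SLE_{8/3}` are excluded by the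
  odd-`k` clause: `L i L⁻¹ = i` iff `L` is complex-linear).
* `stub_similarityRigidity` (open problem, SHARED): rotation-invariant rigidity R*_rot — literally the
  decl `Summit.CriticalPhenomena.SAWScalingLimit.Theses.SAWGaussianRotation.SimilarityRigidity`
  (item stmt-CriticalPhenomena-4453, route SAWGaussianRotation; same content as `RStarRot`,
  stmt-CriticalPhenomena-7298, route SAWIsotropicAnchor): the crux with its lattice clause replaced
  by full similarity covariance. A proof of stmt-4453 closes this stub by name
  (`SimilarityRigidity_holds`), so the line makes the three rigidity routes share one prover effort.

`Rigidity_of : Rigidity` assembles the two stubs BY NAME (no other input).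
-/

namespace Summit.CriticalPhenomena.SAWScalingLimit.Cruxes.Rigidity.IsotropyFirst

open MeasureTheory

/-- stub 1 (hardest; "the quarter-turn bootstraps to isotropy"): the hypotheses of the crux
`Rigidity` verbatim imply covariance under all orientation-preserving similarities `z ↦ c z + w`,
`c ≠ 0` (`ChordalFamily.IsSimilarityCovariant`). Any proof must use the clause with `k` odd: for
even `k` only, `L_* SLE_{8/3}` with `L = diag(1, 2)` satisfies every hypothesis and is not rotation
covariant. -/
theorem stub_isotropyBootstrap : ∀ P : Literature.Probability.RandomPlanarGeometry.ChordalFamily, P.IsChordal → P.IsRestriction → (∃ Q : Literature.Probability.RandomPlanarGeometry.DobrushinDomain → Literature.Probability.RandomPlanarGeometry.CurveClass ℂ → MeasureTheory.Measure (Literature.Probability.RandomPlanarGeometry.CurveClass ℂ), P.IsMarkovExtension Q ∧ ∀ (D : Literature.Probability.RandomPlanarGeometry.DobrushinDomain) (p : Literature.Probability.RandomPlanarGeometry.CurveClass ℂ) (D' : Literature.Probability.RandomPlanarGeometry.DobrushinDomain), D'.carrier ⊆ Literature.Probability.RandomPlanarGeometry.remainingDomain D p → D'.pt 0 = p.target →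 D'.pt 1 = D.pt 1 → ∀ T : Set (Literature.Probability.RandomPlanarGeometry.CurveClass ℂ), MeasurableSet T → P D' T * Q D p (Literature.Probability.RandomPlanarGeometry.CurveClass.rangeSubset (closure D'.carrier)) = Q D p (T ∩ Literature.Probability.RandomPlanarGeometry.CurveClass.rangeSubset (closure D'.carrier))) → (∀ D D' : Literature.Probability.RandomPlanarGeometry.DobrushinDomain, D'.carrier = D.carrier → D'.pt 0 = D.pt 1 → D'.pt 1 = D.pt 0 → P D' = (P D).map Literature.Probability.RandomPlanarGeometry.CurveClass.reverse) → (∀ (D : Literature.Probability.RandomPlanarGeometry.DobrushinDomain) (c : ℂ) (hc : c ≠ 0) (w : ℂ), (∃ (r : ℝ) (k : ℕ), 0 < r ∧ c = (r : ℂ) * Complex.I ^ k) → P (D.map (Literature.Probability.RandomPlanarGeometry.similarity c hc w)) = (P D).map (Literature.Probability.RandomPlanarGeometry.CurveClass.map (Literature.Probability.RandomPlanarGeometry.similarity c hc w : C(ℂ, ℂ)))) → (∀ D : Literature.Probability.RandomPlanarGeometry.DobrushinDomain, P (D.map Complex.conjLIE.toHomeomorph) = (P D).map (Literature.Probability.RandomPlanarGeometry.CurveClass.map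 (Complex.conjLIE.toHomeomorph : C(ℂ, ℂ)))) → (∀ D : Literature.Probability.RandomPlanarGeometry.DobrushinDomain, ∀ᵐ γ ∂(P D), γ ∈ Literature.Probability.RandomPlanarGeometry.CurveClass.simple ∧ γ.range ∩ frontier D.carrier ⊆ {D.pt 0, D.pt 1}) → P.IsSimilarityCovariant := by
  sorry

/-- stub 2 (rotation-invariant rigidity R*_rot, SHARED with item stmt-CriticalPhenomena-4453 of route
SAWGaussianRotation, stated as that very declaration so that `SimilarityRigidity_holds` closes it):
a chordal family with two-sided restriction, the restriction-coupled domain Markov kernel,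
reversibility, covariance under ALL similarities `z ↦ c z + w` and under conjugation, carried by
simple boundary-avoiding curves, is conformally covariant. -/
theorem stub_similarityRigidity : Summit.CriticalPhenomena.SAWScalingLimit.Theses.SAWGaussianRotation.SimilarityRigidity := by
  sorry

/-- Assembly (real proof, no `sorry` of its own): feed the crux hypotheses to
`stub_isotropyBootstrap` to obtain full similarity covariance, then apply
`stub_similarityRigidity` (= `SAWGaussianRotation.SimilarityRigidity` unfolded) with the remaining
hypotheses verbatim. -/
theorem Rigidity_of : Summit.CriticalPhenomena.SAWScalingLimit.Theses.SAWRestrictionRigidity.Rigidity := by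
  intro P hch hres hmk hrev hsim hconj hsimple
  have hiso : P.IsSimilarityCovariant :=
    stub_isotropyBootstrap P hch hres hmk hrev hsim hconj hsimple
  exact stub_similarityRigidity P hch hres hmk hrev hiso hconj hsimple

end Summit.CriticalPhenomena.SAWScalingLimit.Cruxes.Rigidity.IsotropyFirst
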